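import Literature.Geometry.Riemannian.MetricFlowFConvergenceTimewise
import Literature.Geometry.Riemannian.MetricFlowAverageDistanceMonotone
import Literature.Geometry.Riemannian.MetricFlowVarianceBounds
import Literature.Geometry.Riemannian.MetricFlowTimeContinuity
import Literature.Geometry.Riemannian.WassersteinW1Triangle
import HarnessLib

/-!
# Total boundedness of the `𝔽`-distance: tools (Bamler 2023, §7.3, Lemma 7.? (arXiv v1 Lemmas
# 164, 165) and the proof of Thm. 7.4)

R. Bamler, *Compactness theory of the space of super Ricci flows*, Invent. Math. 233 (2023), §7.3,
Lemma 7.? (arXiv v1 Lemma 165): *"… Consider a sequence of metric flow pairs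
`(𝒳^i, (μ^i_t)_{t ∈ I})` representing classes in `𝔽^I_I(H, V, b, r)` … Then there is a
subsequence such that for any `t ∈ I` the following limit exists
`D(t) := lim_{i → ∞} ∫_{𝒳^i_t} ∫_{𝒳^i_t} d^i_t dμ^i_t dμ^i_t < ∞`. Moreover, … `D(t)` is continuous
on the complement of a countable subset and the following holds. Let `J ⊂ I` be a compact subset
such that the restriction `D|_J` is continuous and `ε > 0`. Then there is a subsequence such that
`d_𝔽^J((𝒳^i, (μ^i_t)), (𝒳^j, (μ^j_t))) ≤ |I ∖ J|^{1/2} + ε` for all `i, j`."* and the proof of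
Thm. 7.4 (arXiv v1 Thm. 155): *"Since `D` is continuous almost everywhere, we can use Lemma
[basic measure theory] to find a compact subset `J' ⊂ I` consisting only of points where `D` is
continuous that satisfies `|I ∖ J'| < (εr)²`."*

This file collects the metric-flow tools of the total-boundedness assembly
`MetricFlowFTotalBoundedness.lean` (metric flow pairs over `[a, T]` defined over `(a, T)`, `J = ∅`):

* `MetricFlow.Correspondence₂.extendEmpty` — a correspondence `ℭ` over a window `W ⊆ I` read as a
  correspondence over `I` with EMPTY comparison spaces off `W`
  (`EmptyExtendSpace ℭ t = Σ (h : t ∈ W), Z_t`), `kernelDistWithin_extendEmpty_le`, and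
  `MetricFlowPair.FDistAdmissibleWith.extendEmpty` / `fDist_empty_le_of_fDistAdmissibleWith`: a
  radius `ε` admissible within `ℭ` over `W` with exceptional set `E` gives `d_𝔽 ≤ ρ` as soon as
  `ε ≤ ρ` and `|I ∖ (W ∖ E)| ≤ ρ²` (the step "`d^{I₁}_𝔽 ≤ ε r` over `I₁` with `|I ∖ I₁| ≤ (εr)²`,
  hence `d_𝔽 ≤ …`" of Lemmas 164/165);
* `MetricFlowPair.avgDistReal` — the functions `D_i(t) = ∫∫ d^i_t dμ^i_t dμ^i_t` of Lemma 165 as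
  real functions on `ℝ` (value `0` left of `(a, T)` and `√V` right of it), bounded by `√V`
  (`D_i(t) ≤ √Var(μ_t)`, Hölder) and almost monotone, `D_i(s) − √(H(t − s)) ≤ D_i(t)` (Bamler's
  Lemma 4.7 (4.4), compact slices);
The folklore real-analysis / measure-theory tools of the covering argument are in the main file.

## References

* R. H. Bamler, *Compactness theory of the space of super Ricci flows*, Invent. Math. 233 (2023),
  1121–1277 (arXiv:2008.09298), §7.3, Lemma 7.? (arXiv v1 Lemmas 164, 165) and the proof of
  Thm. 7.4 (arXiv v1 Thm. 155); §4.2 Lemma 4.7; §5.1 Def. 5.6, 5.8. [Bamler2023]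
-/

noncomputable section

open Set MeasureTheory Filter TopologicalSpace Function
open scoped Topology ENNReal NNReal

namespace Literature.Geometry.Riemannian

universe u

/-! ### Extension of a correspondence by empty comparison spaces -/

namespace MetricFlow

namespace Correspondence₂

variable {I₁ I₂ W I : Set ℝ} {𝒳₁ : MetricFlow.{u} I₁} {𝒳₂ : MetricFlow.{u} I₂}

/-- The comparison spaces of the extension `ℭ.extendEmpty`: `Σ (h : t ∈ W), Z_t` — a copy of
`Z_t` for `t ∈ W`, empty otherwise. [cite: Bamler2023, §7.3, Lemma 7.? (arXiv v1 Lemma 164)] -/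
def EmptyExtendSpace (ℭ : Correspondence₂ 𝒳₁ 𝒳₂ W) (t : I) : Type u :=
  Σ h : PLift ((t : ℝ) ∈ W), ℭ.Z ⟨t, h.down⟩

namespace EmptyExtendSpace

variable {ℭ : Correspondence₂ 𝒳₁ 𝒳₂ W} {t : I}

/-- The sum metric (`Metric.Sigma.metricSpace`; there is at most one summand). [folklore] -/
instance instMetricSpace : MetricSpace (EmptyExtendSpace (I := I) ℭ t) := Metric.Sigma.metricSpace

/-- The Borel σ-algebra. [folklore] -/
instance instMeasurableSpace : MeasurableSpace (EmptyExtendSpace (I := I) ℭ t) := borel _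

/-- The Borel σ-algebra. [folklore] -/
instance instBorelSpace : BorelSpace (EmptyExtendSpace (I := I) ℭ t) := ⟨rfl⟩

/-- The inclusion of `Z_t` (`t ∈ W`). [folklore] -/
protected def mk (h : (t : ℝ) ∈ W) (z : ℭ.Z ⟨t, h⟩) : EmptyExtendSpace (I := I) ℭ t := ⟨⟨h⟩, z⟩

/-- The inclusion of `Z_t` is an isometry. [folklore] -/
theorem isometry_mk (h : (t : ℝ) ∈ W) :
    Isometry (EmptyExtendSpace.mk (I := I) (ℭ := ℭ) (t := t) h) :=
  Metric.Sigma.isometry_mk (E := fun h' : PLift ((t : ℝ) ∈ W) ↦ ℭ.Z ⟨t, h'.down⟩) ⟨h⟩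

end EmptyExtendSpace

/-- **A correspondence over a window `W ⊆ I` read as a correspondence over `I`**: the same domains
and embeddings, comparison spaces `EmptyExtendSpace ℭ t = Σ (h : t ∈ W), Z_t` (empty off `W`). In
the `𝔽`-distance over `I` the times of `I ∖ W` then simply join the exceptional set (Bamler 2023,
§7.3, Lemmas 164/165: an estimate of `d^{I₁}_𝔽` over `I₁` with `|I ∖ I₁| ≤ (εr)²` is an estimate
of `d_𝔽` over `I`). [cite: Bamler2023, §7.3, Lemma 7.? (arXiv v1 Lemma 164)] -/
def extendEmpty (ℭ : Correspondence₂ 𝒳₁ 𝒳₂ W) (hW : W ⊆ I) : Correspondence₂ 𝒳₁ 𝒳₂ I where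
  Z := EmptyExtendSpace (I := I) ℭ
  dom₁ := ℭ.dom₁
  dom₂ := ℭ.dom₂
  dom₁_subset := fun _ ht ↦ ⟨(ℭ.dom₁_subset ht).1, hW (ℭ.dom₁_subset ht).2⟩
  dom₂_subset := fun _ ht ↦ ⟨(ℭ.dom₂_subset ht).1, hW (ℭ.dom₂_subset ht).2⟩
  φ₁ := fun t ht x ↦ EmptyExtendSpace.mk (ℭ.dom₁_subset ht).2 (ℭ.φ₁ t ht x)
  φ₂ := fun t ht x ↦ EmptyExtendSpace.mk (ℭ.dom₂_subset ht).2 (ℭ.φ₂ t ht x)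
  isometry₁ := fun t ht ↦ (EmptyExtendSpace.isometry_mk _).comp (ℭ.isometry₁ t ht)
  isometry₂ := fun t ht ↦ (EmptyExtendSpace.isometry_mk _).comp (ℭ.isometry₂ t ht)

/-- The domains of the extension are those of `ℭ`.
[cite: Bamler2023, §7.3, Lemma 7.? (arXiv v1 Lemma 164)] -/
@[simp] theorem extendEmpty_dom₁ (ℭ : Correspondence₂ 𝒳₁ 𝒳₂ W) (hW : W ⊆ I) :
    (ℭ.extendEmpty hW).dom₁ = ℭ.dom₁ := rfl

/-- The domains of the extension are those of `ℭ`.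
[cite: Bamler2023, §7.3, Lemma 7.? (arXiv v1 Lemma 164)] -/
@[simp] theorem extendEmpty_dom₂ (ℭ : Correspondence₂ 𝒳₁ 𝒳₂ W) (hW : W ⊆ I) :
    (ℭ.extendEmpty hW).dom₂ = ℭ.dom₂ := rfl

end Correspondence₂

end MetricFlow

namespace MetricFlowPair

open MetricFlow

/-- **The integrand of the extension is at most that of `ℭ`** (in fact equal): both push-forwards
factor through the isometric embedding `Z_s → Σ_h Z_s` (`wassersteinW1_map_le_of_edist_le`).
[cite: Bamler2023, §7.3, Lemma 7.? (arXiv v1 Lemma 164)] -/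
theorem kernelDistWithin_extendEmpty_le {I₁ I₂ W I : Set ℝ} {P₁ : MetricFlowPair.{u} I₁}
    {P₂ : MetricFlowPair.{u} I₂} (ℭ : Correspondence₂ P₁.flow P₂.flow W) (hW : W ⊆ I) {s t : ℝ}
    (hs₁ : s ∈ ℭ.dom₁) (hs₂ : s ∈ ℭ.dom₂) (ht₁ : t ∈ ℭ.dom₁) (ht₂ : t ∈ ℭ.dom₂)
    (p : P₁.flow.Slice ⟨t, (ℭ.dom₁_subset ht₁).1⟩ × P₂.flow.Slice ⟨t, (ℭ.dom₂_subset ht₂).1⟩) :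
    kernelDistWithin P₁ P₂ (ℭ.extendEmpty hW) hs₁ hs₂ ht₁ ht₂ p ≤
      kernelDistWithin P₁ P₂ ℭ hs₁ hs₂ ht₁ ht₂ p := by
  set M := Correspondence₂.EmptyExtendSpace.mk (I := I) (ℭ := ℭ)
    (t := ⟨s, hW (ℭ.dom₁_subset hs₁).2⟩) (ℭ.dom₁_subset hs₁).2 with hMdef
  have hM : Isometry M := Correspondence₂.EmptyExtendSpace.isometry_mk _
  have hMm : Measurable M := hM.continuous.measurable
  have hφ₁m : Measurable (ℭ.φ₁ s hs₁) := (ℭ.isometry₁ s hs₁).continuous.measurable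
  have hφ₂m : Measurable (ℭ.φ₂ s hs₂) := (ℭ.isometry₂ s hs₂).continuous.measurable
  have key : wassersteinW1
      (((P₁.flow.condKernel p.1 ⟨s, (ℭ.dom₁_subset hs₁).1⟩).map (ℭ.φ₁ s hs₁)).map M)
      (((P₂.flow.condKernel p.2 ⟨s, (ℭ.dom₂_subset hs₂).1⟩).map (ℭ.φ₂ s hs₂)).map M) ≤
      wassersteinW1
        ((P₁.flow.condKernel p.1 ⟨s, (ℭ.dom₁_subset hs₁).1⟩).map (ℭ.φ₁ s hs₁))
        ((P₂.flow.condKernel p.2 ⟨s, (ℭ.dom₂_subset hs₂).1⟩).map (ℭ.φ₂ s hs₂)) :=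
    wassersteinW1_map_le_of_edist_le hMm (fun x y ↦ (hM.edist_eq x y).le) _ _
  rw [Measure.map_map hMm hφ₁m, Measure.map_map hMm hφ₂m] at key
  exact key

/-- **Admissibility passes to the extension, the complement of the window joining the exceptional
set**: if `ε` is admissible within `ℭ` (over `W`) with exceptional set `E`, then every `ρ ≥ ε`
with `|I ∖ (W ∖ E)| ≤ ρ²` is admissible within `ℭ.extendEmpty` (over `I ⊇ W`) with exceptional set
`I ∖ (W ∖ E)` — the same couplings, the integrand being pointwise smaller.
[cite: Bamler2023, §7.3, Lemma 7.? (arXiv v1 Lemma 164)] -/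
theorem FDistAdmissibleWith.extendEmpty {I₁ I₂ W I : Set ℝ} {P₁ : MetricFlowPair.{u} I₁}
    {P₂ : MetricFlowPair.{u} I₂} {ℭ : Correspondence₂ P₁.flow P₂.flow W} {E J : Set ℝ} {ε ρ : ℝ}
    (h : FDistAdmissibleWith P₁ P₂ ℭ E J ε) (hW : W ⊆ I) (hI : MeasurableSet I)
    (hWm : MeasurableSet W) (hερ : ε ≤ ρ)
    (hvol : volume (I \ (W \ E)) ≤ ENNReal.ofReal (ρ ^ 2)) :
    FDistAdmissibleWith P₁ P₂ (ℭ.extendEmpty hW) (I \ (W \ E)) J ρ := by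
  obtain ⟨hε, hEm, _, hJ, hE₁, hE₂, _, q, hq, hint⟩ := h
  have hsub : ∀ {t : ℝ}, t ∈ I \ (I \ (W \ E)) → t ∈ W \ E :=
    fun {t} ht ↦ by_contra fun h' ↦ ht.2 ⟨ht.1, h'⟩
  refine ⟨hε.trans_le hερ, hI.diff (hWm.diff hEm), sdiff_subset, ?_, fun t ht ↦ hE₁ (hsub ht),
    fun t ht ↦ hE₂ (hsub ht), hvol, fun t ht ↦ q t (hsub ht), fun t ht ↦ hq t (hsub ht),
    fun s hs t ht hst ↦ ?_⟩
  · exact fun t ht ↦ ⟨hW (hJ ht).1, fun h' ↦ h'.2 (hJ ht)⟩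
  · exact (lintegral_mono fun p ↦ kernelDistWithin_extendEmpty_le ℭ hW (hE₁ (hsub hs))
      (hE₂ (hsub hs)) (hE₁ (hsub ht)) (hE₂ (hsub ht)) p).trans
      ((hint s (hsub hs) t (hsub ht) hst).trans (ENNReal.ofReal_le_ofReal hερ))

/-- **From an estimate within a correspondence over a window to an estimate of `d_𝔽`**: if `ε` is
admissible within a correspondence `ℭ` over `W ⊆ I` between two metric flow pairs over `I`, with
no exceptional times (`J = ∅`), then `d_𝔽(P₁, P₂) ≤ ρ` whenever `ε ≤ ρ` and `|I ∖ W| ≤ ρ²`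
(Bamler 2023, §7.3, the passage from `d^{I₁}_𝔽 ≤ εr`, `|I ∖ I₁| ≤ (εr)²` to `d_𝔽` in Lemmas
164/165 and Thm. 7.4). [cite: Bamler2023, §7.3, Lemma 7.? (arXiv v1 Lemmas 164, 165)] -/
theorem fDist_empty_le_of_fDistAdmissibleWith {I W : Set ℝ} {P₁ P₂ : MetricFlowPair.{u} I}
    {ℭ : Correspondence₂ P₁.flow P₂.flow W} {ε ρ : ℝ} (h : FDistAdmissibleWith P₁ P₂ ℭ ∅ W ε)
    (hW : W ⊆ I) (hI : MeasurableSet I) (hWm : MeasurableSet W) (hερ : ε ≤ ρ)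
    (hvol : volume (I \ W) ≤ ENNReal.ofReal (ρ ^ 2)) : fDist ∅ P₁ P₂ ≤ ENNReal.ofReal ρ := by
  have h' : FDistAdmissibleWith P₁ P₂ ℭ ∅ ∅ ε := by
    obtain ⟨hε, hEm, hEW, _, hE₁, hE₂, hv, q, hq, hint⟩ := h
    exact ⟨hε, hEm, hEW, empty_subset _, hE₁, hE₂, hv, q, hq, hint⟩
  have hvol' : volume (I \ (W \ ∅)) ≤ ENNReal.ofReal (ρ ^ 2) := by rwa [sdiff_empty]
  exact (fDist_le_fDistWithin (ℭ.extendEmpty hW) ⟨empty_subset _, empty_subset _⟩).trans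
    (fDistWithin_le (h'.extendEmpty hW hI hWm hερ hvol').fDistAdmissible)

/-! ### The average distance as a real function of time -/

variable {a T : ℝ}

/-- **`D(t) = ∫_{𝒳_t}∫_{𝒳_t} d_t dμ_t dμ_t` as a real function on `ℝ`** for a metric flow pair over
`[a, T]` defined over `(a, T)` (Bamler 2023, §7.3, Lemma 165, (7.21)): the real value of
`averageEDist (μ_t)` for `t ∈ (a, T)`, extended by `0` on `(−∞, a]` and by the constant `M` on
`[T, ∞)` (an upper bound in applications, which keeps the almost-monotonicity on `[a, T]`).
[cite: Bamler2023, §7.3, Lemma 7.? (arXiv v1 Lemma 165)] -/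
def avgDistReal (P : MetricFlowPair.{u} (Icc a T)) (hI : Ioo a T ⊆ P.I') (M : ℝ) (t : ℝ) : ℝ :=
  if h : t ∈ Ioo a T then (P.flow.averageEDist (P.μ ⟨t, hI h⟩)).toReal else if t ≤ a then 0 else M

/-- **`∫∫ d_t dμ_t dμ_t ≤ √V`** if `Var(μ_t) ≤ V` (Bamler 2023, proof of Lemma 165: "by Hölder's
inequality we have `D_i(t) ≤ √Var(μ_t) ≤ …`").
[cite: Bamler2023, §7.3, Lemma 7.? (arXiv v1 Lemma 165), proof] -/
theorem averageEDist_μ_le_sqrt {I : Set ℝ} (P : MetricFlowPair.{u} I) {V : ℝ} (hV : 0 ≤ V)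
    (hvar : ∀ t, variance (P.μ t) (P.μ t) ≤ ENNReal.ofReal V) (t : P.I') :
    P.flow.averageEDist (P.μ t) ≤ ENNReal.ofReal (Real.sqrt V) := by
  haveI := P.isProbabilityMeasure_μ t
  calc P.flow.averageEDist (P.μ t) = ∫⁻ x, ∫⁻ y, edist x y ∂(P.μ t) ∂(P.μ t) := rfl
    _ ≤ (variance (P.μ t) (P.μ t)) ^ (1 / 2 : ℝ) := lintegral_lintegral_edist_le_sqrt_variance _ _
    _ ≤ (ENNReal.ofReal V) ^ (1 / 2 : ℝ) := ENNReal.rpow_le_rpow (hvar t) (by norm_num)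
    _ = ENNReal.ofReal (Real.sqrt V) := by
        rw [ENNReal.ofReal_rpow_of_nonneg hV (by norm_num), Real.sqrt_eq_rpow]

section AvgDistReal

variable {P : MetricFlowPair.{u} (Icc a T)} {hI : Ioo a T ⊆ P.I'} {V H : ℝ}

/-- On `(a, T)` the average distance is the `ℝ≥0∞`-value of `avgDistReal` (it is finite if the
variances are bounded). [cite: Bamler2023, §7.3, Lemma 7.? (arXiv v1 Lemma 165), proof] -/
theorem averageEDist_eq_ofReal_avgDistReal (hV : 0 ≤ V)
    (hvar : ∀ t, variance (P.μ t) (P.μ t) ≤ ENNReal.ofReal V) (M : ℝ) {t : ℝ} (ht : t ∈ Ioo a T) :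
    P.flow.averageEDist (P.μ ⟨t, hI ht⟩) = ENNReal.ofReal (P.avgDistReal hI M t) := by
  rw [avgDistReal, dif_pos ht, ENNReal.ofReal_toReal]
  exact ne_top_of_le_ne_top ENNReal.ofReal_ne_top (P.averageEDist_μ_le_sqrt hV hvar _)

/-- **`0 ≤ D_i(t) ≤ √V`** on all of `ℝ` for `M = √V` (Bamler 2023, proof of Lemma 165, Hölder).
[cite: Bamler2023, §7.3, Lemma 7.? (arXiv v1 Lemma 165), proof] -/
theorem avgDistReal_mem_Icc (hV : 0 ≤ V) (hvar : ∀ t, variance (P.μ t) (P.μ t) ≤ ENNReal.ofReal V)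
    (t : ℝ) : P.avgDistReal hI (Real.sqrt V) t ∈ Icc 0 (Real.sqrt V) := by
  unfold avgDistReal
  split_ifs with h
  · refine ⟨ENNReal.toReal_nonneg, ?_⟩
    have := ENNReal.toReal_mono ENNReal.ofReal_ne_top (P.averageEDist_μ_le_sqrt hV hvar ⟨t, hI h⟩)
    rwa [ENNReal.toReal_ofReal (Real.sqrt_nonneg V)] at this
  · exact ⟨le_rfl, Real.sqrt_nonneg V⟩
  · exact ⟨Real.sqrt_nonneg V, le_rfl⟩

/-- **Almost monotonicity `D_i(s) − √(H(t − s)) ≤ D_i(t)` for `s ≤ t` in `[a, T]`** (Bamler 2023,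
proof of Lemma 165: "By Lemma [4.7] we have `D_i(t) − D_i(s) ≥ −√(H(t − s))`", here from
`IsHConcentrated.lintegral_lintegral_edist_conjugateHeatFlow_le` for compact time-slices; the
boundary values `0` at `a` and `√V` at `T` preserve the inequality).
[cite: Bamler2023, §7.3, Lemma 7.? (arXiv v1 Lemma 165), proof] -/
theorem avgDistReal_sub_sqrt_le (hH : 0 ≤ H) (hP : P.flow.IsHConcentrated H) (hV : 0 ≤ V)
    (hvar : ∀ t, variance (P.μ t) (P.μ t) ≤ ENNReal.ofReal V)
    (hcpt : ∀ t, CompactSpace (P.flow.Slice t)) {s t : ℝ} (hst : s ≤ t) :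
    P.avgDistReal hI (Real.sqrt V) s - Real.sqrt (H * (t - s)) ≤
      P.avgDistReal hI (Real.sqrt V) t := by
  have hsq : 0 ≤ Real.sqrt (H * (t - s)) := Real.sqrt_nonneg _
  have hbt := P.avgDistReal_mem_Icc (hI := hI) hV hvar t
  have hbs := P.avgDistReal_mem_Icc (hI := hI) hV hvar s
  by_cases hsa : s ≤ a
  · -- `s = a`: `D(s) = 0`
    have hDs : P.avgDistReal hI (Real.sqrt V) s = 0 := by
      unfold avgDistReal
      rw [dif_neg (fun h : s ∈ Ioo a T ↦ (not_lt.2 hsa) h.1), if_pos hsa]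
    linarith [hbt.1]
  · push Not at hsa
    by_cases htT : t < T
    · -- the interior case `a < s ≤ t < T`: Bamler's Lemma 4.7
      have hsI : s ∈ Ioo a T := ⟨hsa, hst.trans_lt htT⟩
      have htI : t ∈ Ioo a T := ⟨hsa.trans_le hst, htT⟩
      haveI := hcpt ⟨s, hI hsI⟩
      have key := hP.lintegral_lintegral_edist_conjugateHeatFlow_le P.isConjugateHeatFlow
        (s := ⟨s, hI hsI⟩) (t := ⟨t, hI htI⟩) (hI hsI) (hI htI) hst
      have hfin_t : P.flow.averageEDist (P.μ ⟨t, hI htI⟩) ≠ ∞ :=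
        ne_top_of_le_ne_top ENNReal.ofReal_ne_top (P.averageEDist_μ_le_sqrt hV hvar _)
      have hc : (ENNReal.ofReal (H * (t - s))) ^ (1 / 2 : ℝ) =
          ENNReal.ofReal (Real.sqrt (H * (t - s))) := by
        rw [ENNReal.ofReal_rpow_of_nonneg (mul_nonneg hH (sub_nonneg.2 hst)) (by norm_num),
          Real.sqrt_eq_rpow]
      have key' : P.flow.averageEDist (P.μ ⟨s, hI hsI⟩) ≤
          P.flow.averageEDist (P.μ ⟨t, hI htI⟩) + ENNReal.ofReal (Real.sqrt (H * (t - s))) := by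
        rw [← hc]; exact key
      have h1 := ENNReal.toReal_mono (ENNReal.add_ne_top.2 ⟨hfin_t, ENNReal.ofReal_ne_top⟩) key'
      rw [ENNReal.toReal_add hfin_t ENNReal.ofReal_ne_top, ENNReal.toReal_ofReal hsq] at h1
      have hDs : P.avgDistReal hI (Real.sqrt V) s =
          (P.flow.averageEDist (P.μ ⟨s, hI hsI⟩)).toReal := by unfold avgDistReal; rw [dif_pos hsI]
      have hDt : P.avgDistReal hI (Real.sqrt V) t =
          (P.flow.averageEDist (P.μ ⟨t, hI htI⟩)).toReal := by unfold avgDistReal; rw [dif_pos htI]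
      linarith
    · -- `t = T`: `D(t) = √V`
      push Not at htT
      have hDt : P.avgDistReal hI (Real.sqrt V) t = Real.sqrt V := by
        unfold avgDistReal
        rw [dif_neg (fun h : t ∈ Ioo a T ↦ (not_lt.2 htT) h.2),
          if_neg (not_le.2 (hsa.trans_le hst))]
      linarith [hbs.2]

/-- **From the real inequality `D(s) ≤ D(t) + δ` back to `ℝ≥0∞`** on `(a, T)` (the average
distances are finite). [cite: Bamler2023, §7.3, Lemma 7.? (arXiv v1 Lemma 165), proof] -/
theorem averageEDist_le_add_of_avgDistReal_le (hV : 0 ≤ V)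
    (hvar : ∀ t, variance (P.μ t) (P.μ t) ≤ ENNReal.ofReal V) {s t : ℝ} (hs : s ∈ Ioo a T)
    (ht : t ∈ Ioo a T) {δ : ℝ} (hδ : 0 ≤ δ)
    (h : P.avgDistReal hI (Real.sqrt V) s ≤ P.avgDistReal hI (Real.sqrt V) t + δ) :
    P.flow.averageEDist (P.μ ⟨s, hI hs⟩) ≤
      P.flow.averageEDist (P.μ ⟨t, hI ht⟩) + ENNReal.ofReal δ := by
  rw [P.averageEDist_eq_ofReal_avgDistReal hV hvar (Real.sqrt V) hs,
    P.averageEDist_eq_ofReal_avgDistReal hV hvar (Real.sqrt V) ht,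
    ← ENNReal.ofReal_add (P.avgDistReal_mem_Icc hV hvar t).1 hδ]
  exact ENNReal.ofReal_le_ofReal h

end AvgDistReal

end MetricFlowPair

end Literature.Geometry.Riemannian

end
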